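import Summits.AnomalousDissipation.AnomalousDissipation.Theses.VirtualDissipation
import Summits.AnomalousDissipation.AnomalousDissipation.Theses.EnsembleRigidity
import Literature.Analysis.FunctionSpaces.TorusSobolevSpace

/-!
# `LightSteadyStatesGP ⟹ GPMeanBoundedFamily` — the rank-3 crux of route `VirtualDissipation`
# implies the rank-3 crux of route `EnsembleRigidity` outright

Both cruxes pin the same Galloway–Proctor force `f_GP` (the same inline sum of three Stokes modes).
`LightSteadyStatesGP` (stmt-AnomalousDissipation-15151): along some `ν_j → 0` in `(0,1]` there are mean-zero
CLASSICAL STEADY states `(u_j, p_j)` of `NS_{ν_j}(f_GP)` with `∫|u_j|² ≤ 2`.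
`GPMeanBoundedFamily` (stmt-AnomalousDissipation-15509): along some `ν_j → 0` in `(0,1]` there are global
Leray–Hopf solutions of `NS_{ν_j}(f_GP)` with `H`-valued lifts and `ν`-UNIFORMLY bounded mean energy.

The implication is bookkeeping over landed facts: a classical steady state is a global Leray–Hopf solution as a
constant path (`IsClassicalNSSolutionOn.isGlobalLerayHopf`, Robinson–Rodrigo–Sadowski Thm 6.5, tree), its mean
energy is its slice energy (`meanEnergy_eq_of_periodic`), and a smooth solenoidal mean-zero field lifts to `H`
(`Torus.smoothSolenoidal_subset_energySpace`).  Consequence for planning: the two printed-open kernels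
(Constantin–Tarfulea–Vicol 2013 p. 3) are ORDERED — one conjecture-grade item (15151 at level 2) covers both; a
refutation of 15509 refutes 15151.  (Lead c1 of line `Sketch` on crux 15151, cycle 2, 2026-08-17.)
-/

noncomputable section

-- every `Summit.AnomalousDissipation.AnomalousDissipation.…` name repeats the summit = sub-problem segment (D-0017 layout)
set_option linter.dupNamespace false

namespace Summit.AnomalousDissipation.AnomalousDissipation.Theorems.VirtualDissipation.LightSteadyStatesGP

open MeasureTheory Filter Topology
open Literature.Analysis.FunctionSpaces Literature.Analysis.FluidPDE

/-- **`LightSteadyStatesGP → GPMeanBoundedFamily`.**  Light mean-zero classical steady states of `NS_{ν_j}(f_GP)`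
along `ν_j → 0` are, as constant paths, global Leray–Hopf solutions with `H`-valued lifts (themselves) and mean
energy `∫|u_j|² ≤ 2`; so the `VirtualDissipation` crux implies the `EnsembleRigidity` crux with `E = 2`. [folklore] -/
theorem gpMeanBoundedFamily_of_lightSteadyStatesGP
    (h : Summit.AnomalousDissipation.AnomalousDissipation.Theses.VirtualDissipation.LightSteadyStatesGP) :
    Summit.AnomalousDissipation.AnomalousDissipation.Theses.EnsembleRigidity.GPMeanBoundedFamily := by
  intro f hf
  obtain ⟨ν, u, p, hν, hν0, hsol, hmean, hlight⟩ := h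
  subst hf
  have hus : ∀ j, Torus.IsSmooth (u j) := fun j =>
    (hsol j).smooth_velocity.isSmooth_slice (Set.mem_univ (0 : ℝ))
  have hud : ∀ j, Torus.IsDivFree (u j) := fun j => (hsol j).divFree 0 (Set.mem_univ _)
  have hsolen : ∀ j, ((hus j).memLp 2).toLp (u j) ∈ Torus.smoothSolenoidal (Fin 3) := fun j =>
    ⟨u j, hus j, hud j, hmean j, MemLp.coeFn_toLp _⟩
  refine ⟨2, ν, u, fun j _ => u j,
    fun j _ => ⟨((hus j).memLp 2).toLp (u j), Torus.smoothSolenoidal_subset_energySpace (hsolen j)⟩,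
    hν, hν0, fun j => (hsol j).isGlobalLerayHopf, fun j t _ => ((hus j).memLp 2).coeFn_toLp, fun j => ?_⟩
  rw [meanEnergy_eq_of_periodic (τ := 1) (fun _ => rfl) one_pos]
  simpa using hlight j

end Summit.AnomalousDissipation.AnomalousDissipation.Theorems.VirtualDissipation.LightSteadyStatesGP

end
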